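import Literature.Analysis.FluidPDE.LocalTypeIProofs
import Literature.Analysis.FluidPDE.KNSSAxisymmetricNoSwirl
import HarnessLib

/-!
# Route QuantisedSymmetry, item `QuantisedOrder` (stmt-NavierStokesRegularity-11293) — I:
# space–time rotations about the axis on the parabolic balls `Q(0, R)`

Tools for the proof of Lemma Q (`QuantisedSymmetry.QuantisedOrder`): the space–time rotation
`(t, x) ↦ (t, R_θ x)` (`Prod.map id (rotZ θ)`) preserves Lebesgue measure on `ℝ × EuclideanSpace ℝ (Fin 3)` and every
parabolic ball `Q(0, R) = ]-R², 0[ × B_R(0)` about the space–time origin; hence set integrals,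
`L^p` norms and a.e. statements on `Q(0, R)` are invariant under it.  Also: iterating a discrete
rotational equivariance (`u ∘ R_α = R_α ∘ u ⇒ u ∘ R_{mα} = R_{mα} ∘ u`), and the elementary
approximation of an angle `θ ≥ 0` by lattice angles `2πm/n` within `2π/n`.

Pure measure theory / trigonometry; nothing here is specific to the Navier–Stokes equations.

## References

* G. Seregin, V. Šverák, Comm. PDE 34 (2009) = arXiv:0804.1803, §3 (axisymmetric setting).
  [SereginSverak2009]
-/

set_option linter.dupNamespace false

noncomputable section

open MeasureTheory Set Function Filter Topology Metric
open scoped ENNReal NNReal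

namespace Summit.NavierStokesRegularity.NavierStokesRegularity.Theorems.QuantisedOrder

open Literature.Analysis.FluidPDE

/-! ### Discrete equivariance iterates; lattice angles approximate every angle -/

/-- A field equivariant under the rotation `R_α` is equivariant under every iterate `R_{mα}`,
`m ∈ ℕ`. [folklore] -/
theorem equivariant_natMul {w : EuclideanSpace ℝ (Fin 3) → EuclideanSpace ℝ (Fin 3)} {α : ℝ} (h : ∀ x, w (rotZ α x) = rotZ α (w x)) :
    ∀ (m : ℕ) (x : EuclideanSpace ℝ (Fin 3)), w (rotZ ((m : ℝ) * α) x) = rotZ ((m : ℝ) * α) (w x) := by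
  intro m
  induction m with
  | zero => intro x; simp
  | succ m ih =>
      intro x
      have e : ((m + 1 : ℕ) : ℝ) * α = (m : ℝ) * α + α := by push_cast; ring
      rw [e, rotZ_add, ih (rotZ α x), h x, ← rotZ_add]

/-- The lattice angle `2π⌊θ n/(2π)⌋/n` lies in `]θ - 2π/n, θ]` (`θ ≥ 0`, `n ≥ 1`). [folklore] -/
theorem latticeAngle_le_and_lt {θ : ℝ} (hθ : 0 ≤ θ) {n : ℕ} (hn : 0 < n) :
    (⌊θ * n / (2 * Real.pi)⌋₊ : ℝ) * (2 * Real.pi / n) ≤ θ ∧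
      θ < (⌊θ * n / (2 * Real.pi)⌋₊ : ℝ) * (2 * Real.pi / n) + 2 * Real.pi / n := by
  have hπ : 0 < 2 * Real.pi := by positivity
  have hn' : (0 : ℝ) < n := by exact_mod_cast hn
  have hq : 0 ≤ θ * n / (2 * Real.pi) := by positivity
  have h1 : (⌊θ * n / (2 * Real.pi)⌋₊ : ℝ) ≤ θ * n / (2 * Real.pi) := Nat.floor_le hq
  have h2 : θ * n / (2 * Real.pi) < (⌊θ * n / (2 * Real.pi)⌋₊ : ℝ) + 1 := Nat.lt_floor_add_one _
  constructor
  · have h3 := mul_le_mul_of_nonneg_right h1 (le_of_lt (div_pos hπ hn'))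
    have e : θ * n / (2 * Real.pi) * (2 * Real.pi / n) = θ := by
      field_simp
    linarith [h3, e]
  · have h3 := mul_lt_mul_of_pos_right h2 (div_pos hπ hn')
    have e : θ * n / (2 * Real.pi) * (2 * Real.pi / n) = θ := by
      field_simp
    rw [add_mul, one_mul, e] at h3
    exact h3

/-- Hence `|2π⌊θ n/(2π)⌋/n - θ| ≤ 2π/n` (`θ ≥ 0`, `n ≥ 1`). [folklore] -/
theorem abs_latticeAngle_sub_le {θ : ℝ} (hθ : 0 ≤ θ) {n : ℕ} (hn : 0 < n) :
    |(⌊θ * n / (2 * Real.pi)⌋₊ : ℝ) * (2 * Real.pi / n) - θ| ≤ 2 * Real.pi / n := by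
  obtain ⟨h1, h2⟩ := latticeAngle_le_and_lt hθ hn
  rw [abs_le]
  constructor <;> linarith

/-! ### The space–time rotation `(t, x) ↦ (t, R_θ x)` -/

/-- The space–time rotation preserves every parabolic ball about the origin:
`(id × R_θ)⁻¹ Q(0, R) = Q(0, R)`. [folklore] -/
theorem prodMap_rotZ_preimage_parabolicCylinder_zero (θ R : ℝ) :
    Prod.map id (rotZ θ) ⁻¹' parabolicCylinder R (0 : ℝ × EuclideanSpace ℝ (Fin 3)) = parabolicCylinder R (0 : ℝ × EuclideanSpace ℝ (Fin 3)) := by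
  ext z
  simp only [mem_preimage, SuitableCompactness.mem_parabolicCylinder_zero, Prod.map_fst, Prod.map_snd,
    id_eq, norm_rotZ]

/-- Points of `Q(0, R)` stay in `Q(0, R)` under the space–time rotation. [folklore] -/
theorem mem_parabolicCylinder_zero_rotZ {θ R : ℝ} {z : ℝ × EuclideanSpace ℝ (Fin 3)}
    (hz : z ∈ parabolicCylinder R (0 : ℝ × EuclideanSpace ℝ (Fin 3))) :
    (z.1, rotZ θ z.2) ∈ parabolicCylinder R (0 : ℝ × EuclideanSpace ℝ (Fin 3)) := by
  have h : Prod.map id (rotZ θ) z ∈ parabolicCylinder R (0 : ℝ × EuclideanSpace ℝ (Fin 3)) := by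
    rw [← mem_preimage, prodMap_rotZ_preimage_parabolicCylinder_zero]
    exact hz
  exact h

/-- The space–time rotation preserves Lebesgue measure on `ℝ × EuclideanSpace ℝ (Fin 3)`. [folklore] -/
theorem measurePreserving_prodMap_rotZ (θ : ℝ) :
    MeasurePreserving (Prod.map id (rotZ θ)) (volume : Measure (ℝ × EuclideanSpace ℝ (Fin 3))) volume := by
  have h := (MeasurePreserving.id (volume : Measure ℝ)).prod (measurePreserving_rotZ θ)
  rw [Measure.volume_eq_prod]
  exact h

/-- The space–time rotation is a measurable embedding (it is a measurable equivalence with inverse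
the rotation by `-θ`). [folklore] -/
theorem measurableEmbedding_prodMap_rotZ (θ : ℝ) :
    MeasurableEmbedding (Prod.map id (rotZ θ) : ℝ × EuclideanSpace ℝ (Fin 3) → ℝ × EuclideanSpace ℝ (Fin 3)) := by
  have h := (MeasurableEquiv.prodCongr (MeasurableEquiv.refl ℝ)
    (rotZLIE θ).toHomeomorph.toMeasurableEquiv).measurableEmbedding
  exact h

/-- The space–time rotation preserves Lebesgue measure restricted to `Q(0, R)`. [folklore] -/
theorem measurePreserving_prodMap_rotZ_restrict (θ R : ℝ) :
    MeasurePreserving (Prod.map id (rotZ θ))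
      ((volume : Measure (ℝ × EuclideanSpace ℝ (Fin 3))).restrict (parabolicCylinder R (0 : ℝ × EuclideanSpace ℝ (Fin 3))))
      ((volume : Measure (ℝ × EuclideanSpace ℝ (Fin 3))).restrict (parabolicCylinder R (0 : ℝ × EuclideanSpace ℝ (Fin 3)))) := by
  have h := (measurePreserving_prodMap_rotZ θ).restrict_preimage_emb
    (measurableEmbedding_prodMap_rotZ θ) (parabolicCylinder R (0 : ℝ × EuclideanSpace ℝ (Fin 3)))
  rwa [prodMap_rotZ_preimage_parabolicCylinder_zero] at h

/-- **Change of variables** under the space–time rotation on `Q(0, R)` (Bochner integrals):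
`∫_{Q(0,R)} g(t, R_θ x) = ∫_{Q(0,R)} g`. [folklore] -/
theorem setIntegral_comp_prodMap_rotZ {F : Type*} [NormedAddCommGroup F] [NormedSpace ℝ F]
    (θ R : ℝ) (g : ℝ × EuclideanSpace ℝ (Fin 3) → F) :
    ∫ z in parabolicCylinder R (0 : ℝ × EuclideanSpace ℝ (Fin 3)), g (z.1, rotZ θ z.2) =
      ∫ z in parabolicCylinder R (0 : ℝ × EuclideanSpace ℝ (Fin 3)), g z := by
  have h := (measurePreserving_prodMap_rotZ θ).setIntegral_preimage_emb
    (measurableEmbedding_prodMap_rotZ θ) g (parabolicCylinder R (0 : ℝ × EuclideanSpace ℝ (Fin 3)))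
  rw [prodMap_rotZ_preimage_parabolicCylinder_zero] at h
  exact h

/-- **Change of variables** under the space–time rotation on `Q(0, R)` (lower Lebesgue integrals):
`∫⁻_{Q(0,R)} g(t, R_θ x) = ∫⁻_{Q(0,R)} g`. [folklore] -/
theorem setLIntegral_comp_prodMap_rotZ (θ R : ℝ) (g : ℝ × EuclideanSpace ℝ (Fin 3) → ℝ≥0∞) :
    ∫⁻ z in parabolicCylinder R (0 : ℝ × EuclideanSpace ℝ (Fin 3)), g (z.1, rotZ θ z.2) =
      ∫⁻ z in parabolicCylinder R (0 : ℝ × EuclideanSpace ℝ (Fin 3)), g z := by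
  have h := (measurePreserving_prodMap_rotZ θ).setLIntegral_comp_preimage_emb
    (measurableEmbedding_prodMap_rotZ θ) g (parabolicCylinder R (0 : ℝ × EuclideanSpace ℝ (Fin 3)))
  rw [prodMap_rotZ_preimage_parabolicCylinder_zero] at h
  exact h

/-- A.e. statements on `Q(0, R)` pull back along the space–time rotation. [folklore] -/
theorem ae_restrict_comp_prodMap_rotZ (θ R : ℝ) {P : ℝ × EuclideanSpace ℝ (Fin 3) → Prop}
    (h : ∀ᵐ z ∂((volume : Measure (ℝ × EuclideanSpace ℝ (Fin 3))).restrict (parabolicCylinder R (0 : ℝ × EuclideanSpace ℝ (Fin 3)))), P z) :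
    ∀ᵐ z ∂((volume : Measure (ℝ × EuclideanSpace ℝ (Fin 3))).restrict (parabolicCylinder R (0 : ℝ × EuclideanSpace ℝ (Fin 3)))),
      P (z.1, rotZ θ z.2) :=
  (measurePreserving_prodMap_rotZ_restrict θ R).quasiMeasurePreserving.ae h

/-- A.e. statements on all of `ℝ × EuclideanSpace ℝ (Fin 3)` pull back along the space–time rotation. [folklore] -/
theorem ae_comp_prodMap_rotZ (θ : ℝ) {P : ℝ × EuclideanSpace ℝ (Fin 3) → Prop}
    (h : ∀ᵐ z ∂(volume : Measure (ℝ × EuclideanSpace ℝ (Fin 3))), P z) :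
    ∀ᵐ z ∂(volume : Measure (ℝ × EuclideanSpace ℝ (Fin 3))), P (z.1, rotZ θ z.2) :=
  (measurePreserving_prodMap_rotZ θ).quasiMeasurePreserving.ae h

/-- `L^p(Q(0, R))` norms are invariant under the space–time rotation. [folklore] -/
theorem eLpNorm_comp_prodMap_rotZ {F : Type*} [NormedAddCommGroup F] (θ R : ℝ) (p : ℝ≥0∞)
    {g : ℝ × EuclideanSpace ℝ (Fin 3) → F}
    (hg : AEStronglyMeasurable g
      ((volume : Measure (ℝ × EuclideanSpace ℝ (Fin 3))).restrict (parabolicCylinder R (0 : ℝ × EuclideanSpace ℝ (Fin 3))))) :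
    eLpNorm (fun z => g (z.1, rotZ θ z.2)) p
        ((volume : Measure (ℝ × EuclideanSpace ℝ (Fin 3))).restrict (parabolicCylinder R (0 : ℝ × EuclideanSpace ℝ (Fin 3)))) =
      eLpNorm g p ((volume : Measure (ℝ × EuclideanSpace ℝ (Fin 3))).restrict (parabolicCylinder R (0 : ℝ × EuclideanSpace ℝ (Fin 3)))) :=
  eLpNorm_comp_measurePreserving hg (measurePreserving_prodMap_rotZ_restrict θ R)

/-- Composition with the space–time rotation preserves a.e. strong measurability on `Q(0, R)`.
[folklore] -/
theorem aestronglyMeasurable_comp_prodMap_rotZ {F : Type*} [TopologicalSpace F] (θ R : ℝ)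
    {g : ℝ × EuclideanSpace ℝ (Fin 3) → F}
    (hg : AEStronglyMeasurable g
      ((volume : Measure (ℝ × EuclideanSpace ℝ (Fin 3))).restrict (parabolicCylinder R (0 : ℝ × EuclideanSpace ℝ (Fin 3))))) :
    AEStronglyMeasurable (fun z => g (z.1, rotZ θ z.2))
      ((volume : Measure (ℝ × EuclideanSpace ℝ (Fin 3))).restrict (parabolicCylinder R (0 : ℝ × EuclideanSpace ℝ (Fin 3)))) :=
  hg.comp_measurePreserving (measurePreserving_prodMap_rotZ_restrict θ R)

end Summit.NavierStokesRegularity.NavierStokesRegularity.Theorems.QuantisedOrder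

end
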